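import Literature.Analysis.Complex.LaguerrePolyaClass
import HarnessLib

/-!
# Real entire functions of order `< 2` with finitely many non-real zeros are in `𝓛𝓟*`

Topic `Literature/Analysis/Complex` (trunk T-CA); theorem-only companion of
`LaguerrePolyaClass.lean` (definitions `IsLaguerrePolya`, `IsLaguerrePolyaStar`, `nonrealZeroCount`).
Everything here is PROVED; no definitions, no named facts.

Ki–Kim 2000, §2 (Duke Math. J. 104, p. 49) define the class `𝔏` of "all real entire functions of
genus `1*` that have finitely many nonreal zeros" and record ((2.1), via the Laguerre–Pólya theorem)
that `𝔏` is exactly Kim's `𝓛𝓟*` = {real polynomial} · {Laguerre–Pólya class}. This file proves the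
Hadamard-free, order-`< 2` instance of that identification, which is the entrance ticket for the
functions the tree actually handles (`IsEntireOfOrderLt 2`, e.g. `Ξ`-like functions and the class of
`Literature/Barriers/RiemannHypothesis/JensenPolynomialsKimProofs.lean`):

* `Literature.Analysis.Complex.isLaguerrePolyaStar_of_isEntireOfOrderLt_two` — **a real entire
  function of order `< 2` with only finitely many non-real zeros is in `𝓛𝓟*`.**

Proof (as in Ki–Kim's (2.1), without Hadamard's factorisation): induction on the number of non-real
zeros. A non-real zero `c` of order `n` comes with the conjugate zero `c̄` of the same order
(`DeBruijn1950.analyticOrderAt_conj`); dividing by the real polynomial `((z − c)(z − c̄))ⁿ` leaves an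
entire function that is again real on `ℝ`, again of order `< 2` (the polynomial factor has modulus
`≥ 1` outside a disc), with the pair `c, c̄` removed from its zero set; with no non-real zeros left,
the order-`< 2` Laguerre–Pólya theorem of the class file
(`isLaguerrePolya_of_isEntireOfOrderLt_two`, from de Bruijn's Thm. 6) applies.

## References

* H. Ki, Y.-O. Kim, Duke Math. J. 104 (2000) 45–73, §2 p. 49 and eq. (2.1) [KiKim2000].
* Y.-O. Kim, Proc. Amer. Math. Soc. 109 (1990) 1045–1052, §1 [Kim1990].
-/

noncomputable section

open Complex Filter Metric Set Topology Polynomial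
open scoped ComplexConjugate

namespace Literature.Analysis.Complex

section OrderLtTwoStar

variable {f : ℂ → ℂ}

/-- `exists_eq_pow_mul_of_entire` translated to a point `a`, with the exponent identified as the
vanishing order: `f(z) = (z − a)ⁿ g(z)`, `g` entire, `g(a) ≠ 0`, `n = ord_a f`. [folklore] -/
private theorem exists_eq_sub_pow_mul (hf : Differentiable ℂ f) (hne : ∃ z, f z ≠ 0) (a : ℂ) :
    ∃ (n : ℕ) (g : ℂ → ℂ), Differentiable ℂ g ∧ g a ≠ 0 ∧ (∀ z, f z = (z - a) ^ n * g z) ∧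
      analyticOrderAt f a = n := by
  have hfa : Differentiable ℂ (fun w ↦ f (w + a)) := hf.comp (differentiable_id.add_const a)
  have hnea : ∃ w, (fun w ↦ f (w + a)) w ≠ 0 := by
    obtain ⟨z, hz⟩ := hne
    exact ⟨z - a, by simpa using hz⟩
  obtain ⟨n, g, hg, hg0, hfg⟩ := DeBruijn1950.exists_eq_pow_mul_of_entire hfa hnea
  have hg' : Differentiable ℂ (fun z ↦ g (z - a)) := hg.comp (differentiable_id.sub_const a)
  have hfac : ∀ z, f z = (z - a) ^ n * g (z - a) := fun z ↦ by
    have := hfg (z - a)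
    simpa using this
  refine ⟨n, fun z ↦ g (z - a), hg', by simpa using hg0, hfac, ?_⟩
  have h1 : AnalyticAt ℂ ((· - a) ^ n) a := by fun_prop
  have h2 : AnalyticAt ℂ (fun z ↦ g (z - a)) a := hg'.analyticAt a
  have hfun : f = ((· - a) ^ n) * fun z ↦ g (z - a) := by
    funext z
    rw [hfac z]
    rfl
  rw [hfun, analyticOrderAt_mul h1 h2, analyticOrderAt_centeredMonomial,
    h2.analyticOrderAt_eq_zero.2 (by simpa using hg0), add_zero]

/-- **Dividing out a conjugate pair of non-real zeros.** For `f` entire, real on `ℝ`, `f ≢ 0`, and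
a non-real zero `c` of order `n ≥ 1`: `f(z) = ((z − c)(z − c̄))ⁿ h(z)` with `h` entire, real on `ℝ`,
`h(c) ≠ 0 ≠ h(c̄)` (the order at `c̄` is also `n`, by `f(z̄) = f(z)^*`).
[cite: KiKim2000, §2 eq. (2.1)] -/
private theorem exists_eq_conjPair_pow_mul (hf : Differentiable ℂ f) (hreal : IsRealOnReal f)
    (hne : ∃ z, f z ≠ 0) {c : ℂ} (hc : f c = 0) (hci : c.im ≠ 0) :
    ∃ (n : ℕ) (h : ℂ → ℂ), 0 < n ∧ Differentiable ℂ h ∧ IsRealOnReal h ∧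
      (∀ z, f z = ((z - c) * (z - conj c)) ^ n * h z) ∧ h c ≠ 0 ∧ h (conj c) ≠ 0 := by
  have hsymm : ∀ z, f (conj z) = conj (f z) := apply_conj_eq_conj hf hreal
  obtain ⟨n, g, hg, hgc, hfg, hord⟩ := exists_eq_sub_pow_mul hf hne c
  have hn : 0 < n := by
    rcases Nat.eq_zero_or_pos n with h0 | h0
    · exfalso
      apply hgc
      have := hfg c
      rw [h0, pow_zero, one_mul] at this
      rw [← this, hc]
    · exact h0
  have hcc : c - conj c ≠ 0 := by
    rw [sub_ne_zero]
    intro h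
    have := congrArg Complex.im h
    simp only [Complex.conj_im] at this
    exact hci (by linarith)
  -- the order of `g` at `c̄` is `n`
  have hordg : analyticOrderAt g (conj c) = n := by
    have h1 : AnalyticAt ℂ ((· - c) ^ n) (conj c) := by fun_prop
    have h2 : AnalyticAt ℂ g (conj c) := hg.analyticAt _
    have hF : analyticOrderAt f (conj c) = n := by
      rw [DeBruijn1950.analyticOrderAt_conj hf hsymm, hord]
    have hfun : f = ((· - c) ^ n) * g := by
      funext z
      rw [hfg z]
      rfl
    have hne1 : ((· - c) ^ n) (conj c) ≠ 0 := by
      show (conj c - c) ^ n ≠ 0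
      exact pow_ne_zero _ (fun h ↦ hcc (by rw [← neg_sub, h, neg_zero]))
    rw [hfun, analyticOrderAt_mul h1 h2, h1.analyticOrderAt_eq_zero.2 hne1, zero_add] at hF
    exact hF
  obtain ⟨n', h, hh, hhc', hgh, hord'⟩ := exists_eq_sub_pow_mul hg ⟨c, hgc⟩ (conj c)
  have hn' : n' = n := by
    have := hord'.symm.trans hordg
    exact_mod_cast this
  subst hn'
  have hfh : ∀ z, f z = ((z - c) * (z - conj c)) ^ n' * h z := fun z ↦ by
    rw [hfg, hgh, mul_pow]
    ring
  refine ⟨n', h, hn, hh, fun x ↦ ?_, hfh, fun h0 ↦ hgc ?_, hhc'⟩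
  · -- `h` is real on `ℝ`: `h(x) = f(x) / ((x − Re c)² + (Im c)²)ⁿ`
    have hq : ((x : ℂ) - c) * ((x : ℂ) - conj c) = (((x - c.re) ^ 2 + c.im ^ 2 : ℝ) : ℂ) := by
      apply Complex.ext
      · simp [sq, Complex.mul_re]
      · simp [sq, Complex.mul_im]
        ring
    have hpos : 0 < (x - c.re) ^ 2 + c.im ^ 2 := by positivity
    have hqne : ((((x - c.re) ^ 2 + c.im ^ 2 : ℝ) : ℂ)) ^ n' ≠ 0 :=
      pow_ne_zero _ (Complex.ofReal_ne_zero.2 hpos.ne')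
    have hx : h x = f x / ((((x - c.re) ^ 2 + c.im ^ 2 : ℝ) : ℂ)) ^ n' := by
      rw [hfh, hq, mul_div_cancel_left₀ _ hqne]
    rw [hx, ← Complex.ofReal_pow, Complex.div_ofReal_im, hreal x, zero_div]
  · rw [hgh, h0, mul_zero]

/-- **Growth of the quotient.** If `f` has order `< 2` and `f = ((z − c)(z − c̄))ⁿ h` with `h`
entire, then `h` has order `< 2` (the polynomial factor has modulus `≥ 1` off the disc
`|z| ≤ |c| + 1`; on the disc `h` is bounded). [folklore] -/
private theorem isEntireOfOrderLt_two_quotient {h : ℂ → ℂ} (hf : IsEntireOfOrderLt 2 f)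
    (hh : Differentiable ℂ h) {c : ℂ} {n : ℕ}
    (hfh : ∀ z, f z = ((z - c) * (z - conj c)) ^ n * h z) : IsEntireOfOrderLt 2 h := by
  obtain ⟨hfd, ρ, C, hρ, hgr⟩ := hf
  obtain ⟨σ, C', hσ0, hσ, hC', hgr'⟩ := DeBruijn1950.growth_normalise_two hfd hρ hgr
  obtain ⟨M, hM⟩ := (isCompact_closedBall (0 : ℂ) (‖c‖ + 1)).exists_bound_of_continuousOn
    hh.continuous.continuousOn
  refine ⟨hh, σ, max C' M, hσ, fun z ↦ ?_⟩
  have hexp : 1 ≤ Real.exp (‖z‖ ^ σ) := Real.one_le_exp (by positivity)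
  have hmax0 : 0 ≤ max C' M := le_trans (by linarith) (le_max_left _ _)
  by_cases hz : ‖z‖ ≤ ‖c‖ + 1
  · calc ‖h z‖ ≤ M := hM z (mem_closedBall_zero_iff.2 hz)
      _ ≤ max C' M * 1 := by rw [mul_one]; exact le_max_right _ _
      _ ≤ max C' M * Real.exp (‖z‖ ^ σ) := by gcongr
  · rw [not_le] at hz
    have h1 : 1 ≤ ‖z - c‖ := by
      have := norm_sub_norm_le z c
      linarith
    have h2 : 1 ≤ ‖z - conj c‖ := by
      have := norm_sub_norm_le z (conj c)
      rw [Complex.norm_conj] at this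
      linarith
    have hq : 1 ≤ ‖((z - c) * (z - conj c)) ^ n‖ := by
      rw [norm_pow, norm_mul]
      exact one_le_pow₀ (one_le_mul_of_one_le_of_one_le h1 h2)
    calc ‖h z‖ ≤ ‖f z‖ := by
          rw [hfh z, norm_mul]
          exact le_mul_of_one_le_left (norm_nonneg _) hq
      _ ≤ C' * Real.exp (‖z‖ ^ σ) := hgr' z
      _ ≤ max C' M * Real.exp (‖z‖ ^ σ) := by gcongr; exact le_max_left _ _

/-- The set of non-real complex numbers is infinite (so a function with finitely many non-real
zeros is not identically zero). [folklore] -/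
private theorem exists_ne_zero_of_finite_nonreal_zeros (hfin : {z : ℂ | f z = 0 ∧ z.im ≠ 0}.Finite) :
    ∃ z, f z ≠ 0 := by
  by_contra h
  push Not at h
  refine (Set.infinite_of_injective_forall_mem (f := fun k : ℕ ↦ ((k : ℂ) + 1) * I)
    (fun k l hkl ↦ ?_) (fun k ↦ ?_)) hfin
  · have := mul_right_cancel₀ I_ne_zero hkl
    exact_mod_cast add_right_cancel this
  · refine ⟨h _, ?_⟩
    simp only [mul_im, add_re, natCast_re, one_re, I_im, mul_one, add_im,
      natCast_im, one_im, add_zero, I_re, mul_zero]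
    positivity

/-- The real quadratic `X² − 2 (Re c) X + |c|²` evaluates over `ℂ` to `(z − c)(z − c̄)`. [folklore] -/
private theorem eval_conjPairPoly (c z : ℂ) :
    ((X ^ 2 - C (2 * c.re) * X + C (Complex.normSq c) : ℝ[X]).map (algebraMap ℝ ℂ)).eval z
      = (z - c) * (z - conj c) := by
  have h1 : (z - c) * (z - conj c) = z ^ 2 - (c + conj c) * z + c * conj c := by ring
  rw [h1, Complex.add_conj, Complex.mul_conj]
  simp [Polynomial.map_sub, Polynomial.map_mul]

/-- Induction on the number of non-real zeros. [cite: KiKim2000, §2 eq. (2.1)] -/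
private theorem isLaguerrePolyaStar_of_card_le : ∀ (N : ℕ) (F : ℂ → ℂ), IsEntireOfOrderLt 2 F →
    IsRealOnReal F → ∀ hfin : {z : ℂ | F z = 0 ∧ z.im ≠ 0}.Finite, hfin.toFinset.card ≤ N →
    IsLaguerrePolyaStar F := by
  intro N
  induction N with
  | zero =>
    intro F hF hreal hfin hcard
    have hall : ∀ z, F z = 0 → z.im = 0 := by
      intro z hz
      by_contra hzi
      have hmem : z ∈ hfin.toFinset := hfin.mem_toFinset.2 ⟨hz, hzi⟩
      have := Finset.card_pos.2 ⟨z, hmem⟩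
      omega
    exact (isLaguerrePolya_of_isEntireOfOrderLt_two hF hreal hall).isLaguerrePolyaStar
  | succ N ih =>
    intro F hF hreal hfin hcard
    by_cases hall : ∀ z, F z = 0 → z.im = 0
    · exact (isLaguerrePolya_of_isEntireOfOrderLt_two hF hreal hall).isLaguerrePolyaStar
    push Not at hall
    obtain ⟨c, hc, hci⟩ := hall
    have hne : ∃ z, F z ≠ 0 := exists_ne_zero_of_finite_nonreal_zeros hfin
    obtain ⟨n, h, -, hh, hhreal, hFh, hhc, -⟩ := exists_eq_conjPair_pow_mul hF.1 hreal hne hc hci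
    have hh2 : IsEntireOfOrderLt 2 h := isEntireOfOrderLt_two_quotient hF hh hFh
    -- the non-real zeros of `h` are those of `F` other than `c` (and `c̄`)
    have hsub : ∀ z, h z = 0 ∧ z.im ≠ 0 → (F z = 0 ∧ z.im ≠ 0) ∧ z ≠ c := by
      rintro z ⟨hz, hzi⟩
      refine ⟨⟨by rw [hFh z, hz, mul_zero], hzi⟩, ?_⟩
      rintro rfl
      exact hhc hz
    have hfin' : {z : ℂ | h z = 0 ∧ z.im ≠ 0}.Finite :=
      hfin.subset fun z hz ↦ (hsub z hz).1
    have hcard' : hfin'.toFinset.card ≤ N := by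
      have hcmem : c ∈ hfin.toFinset := hfin.mem_toFinset.2 ⟨hc, hci⟩
      have hsub' : hfin'.toFinset ⊆ hfin.toFinset.erase c := by
        intro z hz
        rw [Finset.mem_erase]
        obtain ⟨hzF, hzc⟩ := hsub z (hfin'.mem_toFinset.1 hz)
        exact ⟨hzc, hfin.mem_toFinset.2 hzF⟩
      have := Finset.card_le_card hsub'
      rw [Finset.card_erase_of_mem hcmem] at this
      omega
    obtain ⟨p, φ, hφ, hhe⟩ := ih h hh2 hhreal hfin' hcard'
    refine ⟨(X ^ 2 - C (2 * c.re) * X + C (Complex.normSq c)) ^ n * p, φ, hφ, fun z ↦ ?_⟩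
    rw [hFh z, hhe z, Polynomial.map_mul, Polynomial.map_pow, eval_mul, eval_pow,
      eval_conjPairPoly]
    ring

/-- **Real entire functions of order `< 2` with finitely many non-real zeros are in `𝓛𝓟*`**
(the order-`< 2`, Hadamard-free instance of Ki–Kim's `𝔏 = 𝓛𝓟*`: divide out the conjugate pairs
of non-real zeros with multiplicity and apply the Laguerre–Pólya theorem to the quotient).
[cite: KiKim2000, §2 p. 49, eq. (2.1)] [cite: Kim1990, §1 p. 1045] -/
theorem isLaguerrePolyaStar_of_isEntireOfOrderLt_two {F : ℂ → ℂ} (hF : IsEntireOfOrderLt 2 F)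
    (hreal : IsRealOnReal F) (hfin : {z : ℂ | F z = 0 ∧ z.im ≠ 0}.Finite) :
    IsLaguerrePolyaStar F :=
  isLaguerrePolyaStar_of_card_le _ F hF hreal hfin le_rfl

/-- The same with the growth hypothesis unbundled (`‖F z‖ ≤ C e^{‖z‖^ρ}`, `ρ < 2`).
[cite: KiKim2000, §2 p. 49, eq. (2.1)] -/
theorem isLaguerrePolyaStar_of_growth {F : ℂ → ℂ} (hF : Differentiable ℂ F) {ρ C : ℝ}
    (hρ : ρ < 2) (hgr : ∀ z, ‖F z‖ ≤ C * Real.exp (‖z‖ ^ ρ)) (hreal : ∀ x : ℝ, (F x).im = 0)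
    (hfin : {z : ℂ | F z = 0 ∧ z.im ≠ 0}.Finite) : IsLaguerrePolyaStar F :=
  isLaguerrePolyaStar_of_isEntireOfOrderLt_two ⟨hF, ρ, C, hρ, hgr⟩ hreal hfin

/-- Conversely (for the record, in the same vocabulary): a member of `𝓛𝓟*` is real entire with
finitely many non-real zeros, or identically zero. [cite: KiKim2000, §2 p. 49, eq. (2.1)] -/
theorem IsLaguerrePolyaStar.isRealOnReal_and_finite {F : ℂ → ℂ} (hF : IsLaguerrePolyaStar F)
    (h0 : ∃ w, F w ≠ 0) :
    Differentiable ℂ F ∧ IsRealOnReal F ∧ {z : ℂ | F z = 0 ∧ z.im ≠ 0}.Finite :=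
  ⟨hF.differentiable, hF.isRealOnReal, hF.finite_nonreal_zeros h0⟩

end OrderLtTwoStar

end Literature.Analysis.Complex

end
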